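import Mathlib
import Literature.AlgebraicGeometry.Resolution.WeightedInitialTermsIndexed
import Literature.AlgebraicGeometry.Resolution.PolygonInvariants
import HarnessLib

/-!
# The characteristic polygon of an idealistic exponent `(J, μ)` with a block of `r` y-variables: integer invariants
# (Cossart–Jannsen–Saito Def. 11.1 expansion-free, embedding dimension `r + 2`)

Topic: `Literature/AlgebraicGeometry/Resolution`. Dimension-general form of `Resolution/PolygonInvariants.lean` (regular local ring of
dimension `3`, ONE y-variable): fourth brick of the generalisation `Fin 3 → Fin (r+2)` of the tree's expansion-free rendering of
Hironaka's characteristic polyhedra, needed by Cossart–Jannsen–Saito's key theorem 6.40 for `e = 2` in arbitrary embedding dimension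
(memo `run/shared/lean/pub/res-hironaka/L/res-L1-w42-stub-3/KEYCLAIM-PORT-PLAN.md` §4). Setting: a regular local ring `R` of dimension
`r + 2` with regular system of parameters `c = Fin.append y u = (y₁, …, y_r, u₁, u₂) : Fin (r + 2) → R` (the tree's convention of
`AdmissibleParameters.lean`), an ideal `J` (in the applications `J ⊆ 𝔪^μ`). Hironaka's polygon `Δ(J; u₁, u₂; y) ⊂ ℝ²_{≥0}` (CJS Def. 8.2
/ Def. 11.1: the points `A/(nᵢ − |B|)` of a presentation `Σ C_{A,B} y^B u^A`, `|B| = b₁ + ⋯ + b_r`) is read off the Newton point set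
`WeightedOrder.occ c J` of `WeightedInitialTermsIndexed.lean`: the points are `pt(e) = (e_{u₁}, e_{u₂})/(μ − |e|_y)` for the Newton points
`e` of y-degree `|e|_y = ydeg e < μ`; we scale by `L = μ!` so that everything is a NATURAL NUMBER (`spt₁ e = e_{u₁} · L/(μ − |e|_y)`, …),
exactly as in the `Fin 3` file, whose statements and proofs are repeated verbatim with `e 0 ↦ ydeg e`, `e 1 ↦ e u₁`, `e 2 ↦ e u₂` and the
weights `(w₀, Lp₁, Lp₂) ↦ (w₀, …, w₀, Lp₁, Lp₂)`.

PROVED (namespace `Literature.AlgebraicGeometry.Resolution.WeightedOrder`):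
* `u1`, `u2`, `ydeg`, `degree_eq_ydeg_add`; `sfac`, `spt₁`, `spt₂`, `pts`; `levelWeight μ w₀ p₁ p₂ = (w₀, …, w₀, L p₁, L p₂)` and the
  **bridge** `le_weightedOrderIdeal_levelWeight_iff`: `J ⊆ F^{(w₀,…,w₀,Lp₁,Lp₂)}_{w₀ μ} ⟺ ∀ e ∈ pts, p₁ spt₁ e + p₂ spt₂ e ≥ w₀`
  (the half-planes containing the polygon are the weighted order ideals containing `J`, CJS Remark 8.9 (2));
* the scaled invariants `deltaS, alphaS, betaS, epsS, zetaS, gammaMinusS, gammaPlusS` (Def. 11.1), their attainment by Newton points, the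
  inequalities `ε ≤ γ⁻ ≤ γ⁺ ≤ β`, `α + γ⁺ ≤ δ ≤ α + β`, `ζ + ε ≥ δ` ((11.1));
* realisation weights `isInitialTerm_levelWeight_of_isMinOn` (with `isMinOn_lex` of the `Fin 3` file: a Newton point minimising a positive form is an initial unit
  term for the corresponding level weight — the tool that transports vertices through charts).

Source: V. Cossart, U. Jannsen, S. Saito, LNM **2270** (2020), Def. 8.2, Lemma 8.3/8.4/8.6, Remark 8.9, Def. 11.1, (11.1), (11.4)
[`CossartJannsenSaito2020`]; V. Cossart, O. Piltant, J. Algebra 320 (2008), §4 [`CossartPiltant2008`]; H. Hironaka, J. Math. Kyoto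
Univ. 7 (1967) [`Hironaka1967`]. No named facts; no instance, notation or attribute; nothing about schemes.
-/

noncomputable section

open IsLocalRing MvPolynomial

namespace Literature.AlgebraicGeometry.Resolution

namespace WeightedOrder

universe u

variable {R : Type u} [CommRing R] {r : ℕ}

/-! ## The y-block and the two boundary indices -/

/-- The index of `u₁` in `(y₁, …, y_r, u₁, u₂) : Fin (r + 2) → R`. [cite: CossartJannsenSaito2020, Def. 8.2] -/
def u1 (r : ℕ) : Fin (r + 2) := Fin.natAdd r 0

/-- The index of `u₂` in `(y₁, …, y_r, u₁, u₂) : Fin (r + 2) → R`. [cite: CossartJannsenSaito2020, Def. 8.2] -/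
def u2 (r : ℕ) : Fin (r + 2) := Fin.natAdd r 1

/-- The y-degree `|e|_y = Σ_{i < r} e_{y_i}` of an exponent (CJS's `|B| = b₁ + ⋯ + b_r`). [cite: CossartJannsenSaito2020, Def. 7.2 (1)] -/
def ydeg (e : Fin (r + 2) →₀ ℕ) : ℕ := ∑ i : Fin r, e (Fin.castAdd 2 i)

/-- `|e| = |e|_y + e_{u₁} + e_{u₂}`. [cite: CossartJannsenSaito2020, Def. 7.2 (1)] -/
theorem degree_eq_ydeg_add (e : Fin (r + 2) →₀ ℕ) : e.degree = ydeg e + e (u1 r) + e (u2 r) := by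
  rw [Finsupp.degree_eq_weight_one]
  change Finsupp.weight (fun _ => 1) e = _
  rw [Finsupp.weight_apply, Finsupp.sum_fintype _ _ (by simp), Fin.sum_univ_add, Fin.sum_univ_two, ydeg]
  simp only [smul_eq_mul, mul_one, u1, u2]
  ring

/-! ## Scaled points -/

/-- The scale factor `L/(μ − |e|_y)`, `L = μ!`, of an exponent with `|e|_y < μ`. [cite: CossartJannsenSaito2020, Lemma 8.6] -/
def sfac (μ : ℕ) (e : Fin (r + 2) →₀ ℕ) : ℕ := μ.factorial / (μ - ydeg e)

/-- `(μ − |e|_y) · L/(μ − |e|_y) = L`. [cite: CossartJannsenSaito2020, Def. 11.1] -/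
theorem sub_mul_sfac {μ : ℕ} {e : Fin (r + 2) →₀ ℕ} (he : ydeg e < μ) :
    (μ - ydeg e) * sfac μ e = μ.factorial := by
  rw [sfac, mul_comm]
  exact Nat.div_mul_cancel (Nat.dvd_factorial (by omega) (by omega))

/-- The scale factor is positive. [cite: CossartJannsenSaito2020, Def. 11.1] -/
theorem sfac_pos {μ : ℕ} {e : Fin (r + 2) →₀ ℕ} (he : ydeg e < μ) : 0 < sfac μ e := by
  have h := sub_mul_sfac he
  rcases Nat.eq_zero_or_pos (sfac μ e) with h0 | h0
  · rw [h0, mul_zero] at h; exact absurd h.symm (Nat.factorial_pos μ).ne'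
  · exact h0

/-- First scaled coordinate `e₁ · L/(μ − |e|_y)` (`= L ·` abscissa of the point `pt(e)`).
[cite: CossartPiltant2008, §4 p. 10] -/
def spt₁ (μ : ℕ) (e : Fin (r + 2) →₀ ℕ) : ℕ := e (u1 r) * sfac μ e

/-- Second scaled coordinate `e₂ · L/(μ − |e|_y)`. [cite: CossartPiltant2008, §4 p. 10] -/
def spt₂ (μ : ℕ) (e : Fin (r + 2) →₀ ℕ) : ℕ := e (u2 r) * sfac μ e

/-- The Newton points of `J` of y-degree `< μ` — those defining the polygon of `(J, μ)`.
[cite: CossartPiltant2008, §4 p. 10] [cite: CossartJannsenSaito2020, Def. 8.2 (1)] -/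
def pts (c : Fin (r + 2) → R) (J : Ideal R) (μ : ℕ) : Set (Fin (r + 2) →₀ ℕ) := {e | e ∈ occ c J ∧ ydeg e < μ}

/-- `pts` is monotone in `J`. [cite: CossartJannsenSaito2020, Def. 11.1] -/
theorem pts_mono (c : Fin (r + 2) → R) {J J' : Ideal R} (h : J ≤ J') (μ : ℕ) :
    pts c J μ ⊆ pts c J' μ := fun _ ⟨he, hlt⟩ => ⟨occ_mono c h he, hlt⟩

/-! ## Level weights and the bridge to the weighted order ideals -/

/-- The weight `(w₀, L p₁, L p₂)`: `⟨·, e⟩ ≥ w₀ μ` is the half-plane `p₁ x₁ + p₂ x₂ ≥ w₀` in scaled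
coordinates. [cite: CossartJannsenSaito2020, Remark 8.9 (2)] -/
def levelWeight (μ w₀ p₁ p₂ : ℕ) : Fin (r + 2) → ℕ :=
  Fin.append (fun _ : Fin r => w₀) ![μ.factorial * p₁, μ.factorial * p₂]

/-- The y-block of a level weight is constant `w₀`. [cite: CossartJannsenSaito2020, Remark 8.9 (2)] -/
theorem levelWeight_y (μ w₀ p₁ p₂ : ℕ) (i : Fin r) : levelWeight (r := r) μ w₀ p₁ p₂ (Fin.castAdd 2 i) = w₀ := by
  simp [levelWeight]

/-- The `u₁`-component of a level weight. [cite: CossartJannsenSaito2020, Remark 8.9 (2)] -/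
theorem levelWeight_u1 (μ w₀ p₁ p₂ : ℕ) : levelWeight (r := r) μ w₀ p₁ p₂ (u1 r) = μ.factorial * p₁ := by
  simp [levelWeight, u1]

/-- The `u₂`-component of a level weight. [cite: CossartJannsenSaito2020, Remark 8.9 (2)] -/
theorem levelWeight_u2 (μ w₀ p₁ p₂ : ℕ) : levelWeight (r := r) μ w₀ p₁ p₂ (u2 r) = μ.factorial * p₂ := by
  simp [levelWeight, u2]

/-- Level weights with positive entries are positive. [cite: CossartJannsenSaito2020, Def. 11.1] -/
theorem levelWeight_pos {μ w₀ p₁ p₂ : ℕ} (hw₀ : 0 < w₀) (hp₁ : 0 < p₁) (hp₂ : 0 < p₂) :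
    ∀ i, 0 < levelWeight (r := r) μ w₀ p₁ p₂ i := by
  intro i
  refine Fin.addCases (fun j => ?_) (fun j => ?_) i
  · rw [levelWeight, Fin.append_left]; exact hw₀
  · rw [levelWeight, Fin.append_right]
    fin_cases j
    · exact Nat.mul_pos (Nat.factorial_pos μ) hp₁
    · exact Nat.mul_pos (Nat.factorial_pos μ) hp₂

/-- The weight of `e` for a level weight. [cite: CossartJannsenSaito2020, Def. 11.1] -/
theorem weight_levelWeight (μ w₀ p₁ p₂ : ℕ) (e : Fin (r + 2) →₀ ℕ) :
    Finsupp.weight (levelWeight μ w₀ p₁ p₂) e = w₀ * ydeg e + μ.factorial * (p₁ * e (u1 r) + p₂ * e (u2 r)) := by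
  rw [Finsupp.weight_apply, Finsupp.sum_fintype _ _ (by simp), Fin.sum_univ_add, Fin.sum_univ_two]
  have hy : ∑ x : Fin r, e (Fin.castAdd 2 x) • levelWeight μ w₀ p₁ p₂ (Fin.castAdd 2 x) = w₀ * ydeg e := by
    rw [ydeg, Finset.mul_sum]
    refine Finset.sum_congr rfl fun x _ => ?_
    rw [levelWeight_y, smul_eq_mul, mul_comm]
  rw [hy]
  simp only [smul_eq_mul, levelWeight, Fin.append_right, Matrix.cons_val_zero, Matrix.cons_val_one, u1, u2]
  ring

/-- For `|e|_y < μ`: `L (p₁ e_{u₁} + p₂ e_{u₂}) = (μ − |e|_y)(p₁ spt₁ e + p₂ spt₂ e)`. [cite: CossartJannsenSaito2020, Def. 11.1] -/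
theorem factorial_mul_eq_sub_mul {μ : ℕ} {e : Fin (r + 2) →₀ ℕ} (he : ydeg e < μ) (p₁ p₂ : ℕ) :
    μ.factorial * (p₁ * e (u1 r) + p₂ * e (u2 r)) = (μ - ydeg e) * (p₁ * spt₁ μ e + p₂ * spt₂ μ e) := by
  rw [← sub_mul_sfac he, spt₁, spt₂]; ring

/-- **Half-plane ⟷ weight inequality** for a Newton point of y-degree `< μ`.
[cite: CossartJannsenSaito2020, Remark 8.9 (2)] -/
theorem le_weight_levelWeight_iff {μ : ℕ} {e : Fin (r + 2) →₀ ℕ} (he : ydeg e < μ) (w₀ p₁ p₂ : ℕ) :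
    w₀ * μ ≤ Finsupp.weight (levelWeight μ w₀ p₁ p₂) e ↔ w₀ ≤ p₁ * spt₁ μ e + p₂ * spt₂ μ e := by
  rw [weight_levelWeight, factorial_mul_eq_sub_mul he]
  set ℓ := p₁ * spt₁ μ e + p₂ * spt₂ μ e with hℓ
  obtain ⟨d, hd, hμ⟩ : ∃ d, 0 < d ∧ μ = ydeg e + d := ⟨μ - ydeg e, by omega, by omega⟩
  have hsub : μ - ydeg e = d := by omega
  rw [hsub, hμ, Nat.mul_add]
  constructor
  · intro h
    have h' : d * w₀ ≤ d * ℓ := by rw [mul_comm d w₀]; omega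
    exact Nat.le_of_mul_le_mul_left h' hd
  · intro h
    have h' : w₀ * d ≤ d * ℓ := by rw [mul_comm]; exact Nat.mul_le_mul_left _ h
    omega

/-- Exponents of y-degree `≥ μ` satisfy every level inequality. [cite: CossartJannsenSaito2020, Def. 11.1] -/
theorem le_weight_levelWeight_of_le {μ : ℕ} {e : Fin (r + 2) →₀ ℕ} (he : μ ≤ ydeg e) (w₀ p₁ p₂ : ℕ) :
    w₀ * μ ≤ Finsupp.weight (levelWeight μ w₀ p₁ p₂) e := by
  rw [weight_levelWeight]
  calc w₀ * μ ≤ w₀ * ydeg e := Nat.mul_le_mul_left _ he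
    _ ≤ _ := Nat.le_add_right _ _

section Regular

variable [IsRegularLocalRing R] (c : Fin (r + 2) → R)
  (hgen : Ideal.span (Set.range c) = maximalIdeal R) (hdim : ringKrullDim R = r + 2)

include hgen hdim in
/-- **Bridge**: for positive `w₀, p₁, p₂`, `J ⊆ F^{(w₀, Lp₁, Lp₂)}_{w₀ μ} ⟺` every point of
`pts c J μ` lies in the half-plane `p₁ x₁ + p₂ x₂ ≥ w₀` (scaled).
[cite: CossartJannsenSaito2020, Remark 8.9 (2)] [cite: CossartPiltant2008, §4 p. 10] -/
theorem le_weightedOrderIdeal_levelWeight_iff (J : Ideal R) {μ w₀ p₁ p₂ : ℕ} (hw₀ : 0 < w₀)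
    (hp₁ : 0 < p₁) (hp₂ : 0 < p₂) :
    J ≤ weightedOrderIdeal c (levelWeight μ w₀ p₁ p₂) (w₀ * μ) ↔
      ∀ e ∈ pts c J μ, w₀ ≤ p₁ * spt₁ μ e + p₂ * spt₂ μ e := by
  rw [le_weightedOrderIdeal_iff_forall_occ c hgen hdim (levelWeight_pos hw₀ hp₁ hp₂) J]
  constructor
  · rintro h e ⟨he, hlt⟩
    exact (le_weight_levelWeight_iff hlt w₀ p₁ p₂).mp (h e he)
  · intro h e he
    by_cases hlt : ydeg e < μ
    · exact (le_weight_levelWeight_iff hlt w₀ p₁ p₂).mpr (h e ⟨he, hlt⟩)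
    · exact le_weight_levelWeight_of_le (not_lt.mp hlt) w₀ p₁ p₂

include hgen hdim in
/-- If `J ⊆ 𝔪^μ` then every point of `pts` satisfies `spt₁ + spt₂ ≥ L` ("`δ ≥ 1`",
CJS Lemma 8.4 (1)). [cite: CossartJannsenSaito2020, Lemma 8.4 (1)] -/
theorem factorial_le_spt_add {J : Ideal R} {μ : ℕ} (hJ : J ≤ maximalIdeal R ^ μ)
    {e : Fin (r + 2) →₀ ℕ} (he : e ∈ pts c J μ) : μ.factorial ≤ spt₁ μ e + spt₂ μ e := by
  obtain ⟨he, hlt⟩ := he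
  have hdeg := le_degree_of_mem_occ c hgen hdim hJ he
  rw [degree_eq_ydeg_add] at hdeg
  rw [spt₁, spt₂, ← add_mul, ← sub_mul_sfac hlt]
  exact Nat.mul_le_mul_right _ (by omega)

end Regular

/-! ## The invariants (scaled by `L = μ!`) -/

section Invariants

variable (c : Fin (r + 2) → R) (J : Ideal R) (μ : ℕ)

/-- `L · δ(J; u; y) = min {spt₁ e + spt₂ e}`. [cite: CossartJannsenSaito2020, Def. 11.1] -/
def deltaS : ℕ := sInf ((fun e => spt₁ μ e + spt₂ μ e) '' pts c J μ)

/-- `L · α = min spt₁`. [cite: CossartJannsenSaito2020, Def. 11.1] [cite: CossartPiltant2008, §4 (14)] -/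
def alphaS : ℕ := sInf (spt₁ μ '' pts c J μ)

/-- `L · β = min {spt₂ e : spt₁ e = L α}` (the ordinate of the vertex `v` of smallest abscissa).
[cite: CossartJannsenSaito2020, Def. 11.1] [cite: CossartPiltant2008, §4 (14)] -/
def betaS : ℕ := sInf (spt₂ μ '' {e | e ∈ pts c J μ ∧ spt₁ μ e = alphaS c J μ})

/-- `L · ε = min spt₂`. [cite: CossartJannsenSaito2020, Def. 11.1] -/
def epsS : ℕ := sInf (spt₂ μ '' pts c J μ)

/-- `L · ζ = min {spt₁ e : spt₂ e = L ε}`. [cite: CossartJannsenSaito2020, Def. 11.1] -/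
def zetaS : ℕ := sInf (spt₁ μ '' {e | e ∈ pts c J μ ∧ spt₂ μ e = epsS c J μ})

/-- `L · γ⁻ = min {spt₂ e : e on the δ-line}`. [cite: CossartJannsenSaito2020, Def. 11.1] -/
def gammaMinusS : ℕ := sInf (spt₂ μ '' {e | e ∈ pts c J μ ∧ spt₁ μ e + spt₂ μ e = deltaS c J μ})

/-- `L · γ⁺ = max {spt₂ e : e on the δ-line}`. [cite: CossartJannsenSaito2020, Def. 11.1] -/
def gammaPlusS : ℕ := sSup (spt₂ μ '' {e | e ∈ pts c J μ ∧ spt₁ μ e + spt₂ μ e = deltaS c J μ})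

variable {c J μ}

/-- `δ` is attained. [cite: CossartJannsenSaito2020, Def. 11.1] -/
theorem exists_pts_deltaS (hne : (pts c J μ).Nonempty) :
    ∃ e ∈ pts c J μ, spt₁ μ e + spt₂ μ e = deltaS c J μ := by
  have := Nat.sInf_mem (hne.image (fun e => spt₁ μ e + spt₂ μ e))
  obtain ⟨e, he, h⟩ := (Set.mem_image _ _ _).mp this
  exact ⟨e, he, h⟩

/-- `δ` is a lower bound. [cite: CossartJannsenSaito2020, Def. 11.1] -/
theorem deltaS_le {e : Fin (r + 2) →₀ ℕ} (he : e ∈ pts c J μ) : deltaS c J μ ≤ spt₁ μ e + spt₂ μ e :=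
  Nat.sInf_le ⟨e, he, rfl⟩

/-- `α` is attained. [cite: CossartJannsenSaito2020, Def. 11.1] -/
theorem exists_pts_alphaS (hne : (pts c J μ).Nonempty) :
    ∃ e ∈ pts c J μ, spt₁ μ e = alphaS c J μ := by
  have := Nat.sInf_mem (hne.image (spt₁ μ))
  obtain ⟨e, he, h⟩ := (Set.mem_image _ _ _).mp this
  exact ⟨e, he, h⟩

/-- `α` is a lower bound. [cite: CossartJannsenSaito2020, Def. 11.1] -/
theorem alphaS_le {e : Fin (r + 2) →₀ ℕ} (he : e ∈ pts c J μ) : alphaS c J μ ≤ spt₁ μ e :=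
  Nat.sInf_le ⟨e, he, rfl⟩

/-- The vertex `v = (α, β)` is attained. [cite: CossartJannsenSaito2020, Def. 11.1] -/
theorem exists_pts_v (hne : (pts c J μ).Nonempty) :
    ∃ e ∈ pts c J μ, spt₁ μ e = alphaS c J μ ∧ spt₂ μ e = betaS c J μ := by
  obtain ⟨e₀, he₀, h₀⟩ := exists_pts_alphaS hne
  have hne' : ({e | e ∈ pts c J μ ∧ spt₁ μ e = alphaS c J μ}).Nonempty := ⟨e₀, he₀, h₀⟩
  have := Nat.sInf_mem (hne'.image (spt₂ μ))
  obtain ⟨e, ⟨he, h1⟩, h2⟩ := (Set.mem_image _ _ _).mp this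
  exact ⟨e, he, h1, h2⟩

/-- `β` is a lower bound on the line `spt₁ = α`. [cite: CossartJannsenSaito2020, Def. 11.1] -/
theorem betaS_le {e : Fin (r + 2) →₀ ℕ} (he : e ∈ pts c J μ) (h1 : spt₁ μ e = alphaS c J μ) :
    betaS c J μ ≤ spt₂ μ e :=
  Nat.sInf_le ⟨e, ⟨he, h1⟩, rfl⟩

/-- `ε` is attained. [cite: CossartJannsenSaito2020, Def. 11.1] -/
theorem exists_pts_epsS (hne : (pts c J μ).Nonempty) :
    ∃ e ∈ pts c J μ, spt₂ μ e = epsS c J μ := by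
  have := Nat.sInf_mem (hne.image (spt₂ μ))
  obtain ⟨e, he, h⟩ := (Set.mem_image _ _ _).mp this
  exact ⟨e, he, h⟩

/-- `ε` is a lower bound. [cite: CossartJannsenSaito2020, Def. 11.1] -/
theorem epsS_le {e : Fin (r + 2) →₀ ℕ} (he : e ∈ pts c J μ) : epsS c J μ ≤ spt₂ μ e :=
  Nat.sInf_le ⟨e, he, rfl⟩

/-- The lowest vertex `(ζ, ε)` is attained. [cite: CossartJannsenSaito2020, Def. 11.1] -/
theorem exists_pts_zeta (hne : (pts c J μ).Nonempty) :
    ∃ e ∈ pts c J μ, spt₂ μ e = epsS c J μ ∧ spt₁ μ e = zetaS c J μ := by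
  obtain ⟨e₀, he₀, h₀⟩ := exists_pts_epsS hne
  have hne' : ({e | e ∈ pts c J μ ∧ spt₂ μ e = epsS c J μ}).Nonempty := ⟨e₀, he₀, h₀⟩
  have := Nat.sInf_mem (hne'.image (spt₁ μ))
  obtain ⟨e, ⟨he, h1⟩, h2⟩ := (Set.mem_image _ _ _).mp this
  exact ⟨e, he, h1, h2⟩

/-- `ζ` is a lower bound on the line `spt₂ = ε`. [cite: CossartJannsenSaito2020, Def. 11.1] -/
theorem zetaS_le {e : Fin (r + 2) →₀ ℕ} (he : e ∈ pts c J μ) (h2 : spt₂ μ e = epsS c J μ) :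
    zetaS c J μ ≤ spt₁ μ e :=
  Nat.sInf_le ⟨e, ⟨he, h2⟩, rfl⟩

/-- The vertex `w⁻ = (δ − γ⁻, γ⁻)` is attained. [cite: CossartJannsenSaito2020, Def. 11.1] -/
theorem exists_pts_wMinus (hne : (pts c J μ).Nonempty) :
    ∃ e ∈ pts c J μ, spt₁ μ e + spt₂ μ e = deltaS c J μ ∧ spt₂ μ e = gammaMinusS c J μ := by
  obtain ⟨e₀, he₀, h₀⟩ := exists_pts_deltaS hne
  have hne' : ({e | e ∈ pts c J μ ∧ spt₁ μ e + spt₂ μ e = deltaS c J μ}).Nonempty :=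
    ⟨e₀, he₀, h₀⟩
  have := Nat.sInf_mem (hne'.image (spt₂ μ))
  obtain ⟨e, ⟨he, h1⟩, h2⟩ := (Set.mem_image _ _ _).mp this
  exact ⟨e, he, h1, h2⟩

/-- `γ⁻` is a lower bound on the `δ`-line. [cite: CossartJannsenSaito2020, Def. 11.1] -/
theorem gammaMinusS_le {e : Fin (r + 2) →₀ ℕ} (he : e ∈ pts c J μ)
    (h : spt₁ μ e + spt₂ μ e = deltaS c J μ) : gammaMinusS c J μ ≤ spt₂ μ e :=
  Nat.sInf_le ⟨e, ⟨he, h⟩, rfl⟩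

/-- The ordinates on the `δ`-line are bounded by `δ`. [cite: CossartJannsenSaito2020, Def. 11.1] -/
theorem bddAbove_deltaLine :
    BddAbove (spt₂ μ '' {e | e ∈ pts c J μ ∧ spt₁ μ e + spt₂ μ e = deltaS c J μ}) := by
  refine ⟨deltaS c J μ, ?_⟩
  rintro _ ⟨e, ⟨-, h⟩, rfl⟩
  omega

/-- The vertex `w⁺ = (δ − γ⁺, γ⁺)` is attained. [cite: CossartJannsenSaito2020, Def. 11.1] -/
theorem exists_pts_wPlus (hne : (pts c J μ).Nonempty) :
    ∃ e ∈ pts c J μ, spt₁ μ e + spt₂ μ e = deltaS c J μ ∧ spt₂ μ e = gammaPlusS c J μ := by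
  obtain ⟨e₀, he₀, h₀⟩ := exists_pts_deltaS hne
  have hne' : ({e | e ∈ pts c J μ ∧ spt₁ μ e + spt₂ μ e = deltaS c J μ}).Nonempty :=
    ⟨e₀, he₀, h₀⟩
  have := Nat.sSup_mem (hne'.image (spt₂ μ)) bddAbove_deltaLine
  obtain ⟨e, ⟨he, h1⟩, h2⟩ := (Set.mem_image _ _ _).mp this
  exact ⟨e, he, h1, h2⟩

/-- `γ⁺` is an upper bound on the `δ`-line. [cite: CossartJannsenSaito2020, Def. 11.1] -/
theorem le_gammaPlusS {e : Fin (r + 2) →₀ ℕ} (he : e ∈ pts c J μ)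
    (h : spt₁ μ e + spt₂ μ e = deltaS c J μ) : spt₂ μ e ≤ gammaPlusS c J μ :=
  le_csSup bddAbove_deltaLine ⟨e, ⟨he, h⟩, rfl⟩

/-! ### Inequalities (CJS (11.1) and the picture below Definition 11.1) -/

/-- `δ ≤ α + β` (the vertex `v` lies in the polygon). [cite: CossartJannsenSaito2020, (11.1)] -/
theorem deltaS_le_alphaS_add_betaS (hne : (pts c J μ).Nonempty) :
    deltaS c J μ ≤ alphaS c J μ + betaS c J μ := by
  obtain ⟨e, he, h1, h2⟩ := exists_pts_v hne
  rw [← h1, ← h2]; exact deltaS_le he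

/-- `γ⁻ ≤ γ⁺`. [cite: CossartJannsenSaito2020, (11.1)] -/
theorem gammaMinusS_le_gammaPlusS (hne : (pts c J μ).Nonempty) :
    gammaMinusS c J μ ≤ gammaPlusS c J μ := by
  obtain ⟨e, he, h1, h2⟩ := exists_pts_wPlus hne
  rw [← h2]; exact gammaMinusS_le he h1

/-- `ε ≤ γ⁻`. [cite: CossartJannsenSaito2020, Def. 11.1] -/
theorem epsS_le_gammaMinusS (hne : (pts c J μ).Nonempty) :
    epsS c J μ ≤ gammaMinusS c J μ := by
  obtain ⟨e, he, -, h2⟩ := exists_pts_wMinus hne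
  rw [← h2]; exact epsS_le he

/-- `α + γ⁺ ≤ δ` (the abscissa of `w⁺` is at least `α`). [cite: CossartJannsenSaito2020, (11.1)] -/
theorem alphaS_add_gammaPlusS_le_deltaS (hne : (pts c J μ).Nonempty) :
    alphaS c J μ + gammaPlusS c J μ ≤ deltaS c J μ := by
  obtain ⟨e, he, h1, h2⟩ := exists_pts_wPlus hne
  have := alphaS_le he
  omega

/-- `γ⁺ ≤ β` (CJS (11.1): `β ≥ γ⁺ ≥ γ⁻`). [cite: CossartJannsenSaito2020, (11.1)] -/
theorem gammaPlusS_le_betaS (hne : (pts c J μ).Nonempty) :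
    gammaPlusS c J μ ≤ betaS c J μ := by
  have h1 := deltaS_le_alphaS_add_betaS hne
  have h2 := alphaS_add_gammaPlusS_le_deltaS hne
  omega

/-- `δ ≤ ζ + ε` (the lowest vertex lies in the polygon). [cite: CossartJannsenSaito2020, Def. 11.1] -/
theorem deltaS_le_zetaS_add_epsS (hne : (pts c J μ).Nonempty) :
    deltaS c J μ ≤ zetaS c J μ + epsS c J μ := by
  obtain ⟨e, he, h2, h1⟩ := exists_pts_zeta hne
  rw [← h1, ← h2]; exact deltaS_le he

/-- `α ≤ ζ`. [cite: CossartJannsenSaito2020, Def. 11.1] -/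
theorem alphaS_le_zetaS (hne : (pts c J μ).Nonempty) : alphaS c J μ ≤ zetaS c J μ := by
  obtain ⟨e, he, -, h1⟩ := exists_pts_zeta hne
  rw [← h1]; exact alphaS_le he

/-- `ε ≤ β`. [cite: CossartJannsenSaito2020, Def. 11.1] -/
theorem epsS_le_betaS (hne : (pts c J μ).Nonempty) : epsS c J μ ≤ betaS c J μ := by
  obtain ⟨e, he, -, h2⟩ := exists_pts_v hne
  rw [← h2]; exact epsS_le he

end Invariants

/-! ## Realization weights: minimisers are single-weight initial terms -/

section Realization

variable [IsRegularLocalRing R] (c : Fin (r + 2) → R)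
  (hgen : Ideal.span (Set.range c) = maximalIdeal R) (hdim : ringKrullDim R = r + 2)

/-- The level weight attached to a minimiser `e⋆` of `ℓ = p₁ spt₁ + p₂ spt₂` takes the value
`ℓ(e⋆) μ` at `e⋆`. [cite: CossartJannsenSaito2020, Def. 11.1] -/
theorem weight_levelWeight_self {μ : ℕ} {e : Fin (r + 2) →₀ ℕ} (he : ydeg e < μ) (p₁ p₂ : ℕ) :
    Finsupp.weight (levelWeight μ (p₁ * spt₁ μ e + p₂ * spt₂ μ e) p₁ p₂) e =
      (p₁ * spt₁ μ e + p₂ * spt₂ μ e) * μ := by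
  rw [weight_levelWeight, factorial_mul_eq_sub_mul he]
  set ℓ := p₁ * spt₁ μ e + p₂ * spt₂ μ e with hℓ
  obtain ⟨d, hμ⟩ : ∃ d, μ = ydeg e + d := ⟨μ - ydeg e, by omega⟩
  have hsub : μ - ydeg e = d := by omega
  rw [hsub, hμ]; ring

include hgen hdim in
/-- **Realization weight of a minimiser**: if `e⋆ ∈ pts c J μ` minimises the positive form
`ℓ = p₁ spt₁ + p₂ spt₂` over `pts c J μ` and `ℓ(e⋆) > 0`, then `J ⊆ F^{(ℓ(e⋆), Lp₁, Lp₂)}_{ℓ(e⋆) μ}`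
and every element of `J` having `e⋆` as an initial unit term (for any positive weight) has `e⋆`
as an initial unit term for the level weight `(ℓ(e⋆), Lp₁, Lp₂)`.
[cite: CossartJannsenSaito2020, Lemma 8.3 (4)] -/
theorem isInitialTerm_levelWeight_of_isMinOn {J : Ideal R} {μ p₁ p₂ : ℕ} (hp₁ : 0 < p₁)
    (hp₂ : 0 < p₂) {e : Fin (r + 2) →₀ ℕ} (he : e ∈ pts c J μ)
    (hmin : ∀ x ∈ pts c J μ, p₁ * spt₁ μ e + p₂ * spt₂ μ e ≤ p₁ * spt₁ μ x + p₂ * spt₂ μ x)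
    (hpos : 0 < p₁ * spt₁ μ e + p₂ * spt₂ μ e) {f : R} (hf : f ∈ J) {w : Fin (r + 2) → ℕ}
    (hw : ∀ i, 0 < w i) (hinit : IsInitialTerm c w f e) :
    IsInitialTerm c (levelWeight μ (p₁ * spt₁ μ e + p₂ * spt₂ μ e) p₁ p₂) f e := by
  set ℓ := p₁ * spt₁ μ e + p₂ * spt₂ μ e with hℓ
  set w' := levelWeight μ ℓ p₁ p₂ with hw'def
  have hw' : ∀ i, 0 < w' i := levelWeight_pos hpos hp₁ hp₂
  have hJ : J ≤ weightedOrderIdeal c w' (ℓ * μ) :=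
    (le_weightedOrderIdeal_levelWeight_iff c hgen hdim J hpos hp₁ hp₂).mpr hmin
  set N := max (Finsupp.weight w e + 1) (Finsupp.weight w' e + 1) with hN
  obtain ⟨F, hFu, -, hFrem⟩ := exists_unitRep c hgen f N
  have hremw : f - eval c F ∈ weightedOrderIdeal c w N :=
    pow_maximalIdeal_le_weightedOrderIdeal c _ hw hgen N hFrem
  have hremw' : f - eval c F ∈ weightedOrderIdeal c w' N :=
    pow_maximalIdeal_le_weightedOrderIdeal c _ hw' hgen N hFrem
  have heF : e ∈ F.support :=
    ((isInitialTerm_iff_of_unitRep c hgen hdim hw hFu hremw (by omega)).mp hinit).1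
  refine (isInitialTerm_iff_of_unitRep c hgen hdim hw' hFu hremw' (by omega)).mpr ⟨heF, ?_⟩
  have hwe : Finsupp.weight w' e = ℓ * μ := weight_levelWeight_self he.2 p₁ p₂
  have hle : ℓ * μ ≤ N := by omega
  have hall := (mem_weightedOrderIdeal_iff_of_unitRep c hgen hdim hw' hFu hremw' hle).mp (hJ hf)
  intro m hm
  rw [hwe]; exact hall m hm

include hgen hdim in
/-- Every point of `pts` is an initial unit term of some element of `J` for the level weight of
any positive form it minimises. [cite: CossartJannsenSaito2020, Lemma 8.3 (4)] -/
theorem exists_isInitialTerm_levelWeight_of_isMinOn {J : Ideal R} {μ p₁ p₂ : ℕ} (hp₁ : 0 < p₁)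
    (hp₂ : 0 < p₂) {e : Fin (r + 2) →₀ ℕ} (he : e ∈ pts c J μ)
    (hmin : ∀ x ∈ pts c J μ, p₁ * spt₁ μ e + p₂ * spt₂ μ e ≤ p₁ * spt₁ μ x + p₂ * spt₂ μ x)
    (hpos : 0 < p₁ * spt₁ μ e + p₂ * spt₂ μ e) :
    ∃ f ∈ J, IsInitialTerm c (levelWeight μ (p₁ * spt₁ μ e + p₂ * spt₂ μ e) p₁ p₂) f e := by
  have he' := he
  obtain ⟨⟨f, hf, w, hw, hinit⟩, -⟩ := he'
  exact ⟨f, hf, isInitialTerm_levelWeight_of_isMinOn c hgen hdim hp₁ hp₂ he hmin hpos hf hw hinit⟩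

end Realization

end WeightedOrder

end Literature.AlgebraicGeometry.Resolution

end
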